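import Literature.NumberTheory.LFunctions.RodgersTaoZeroContinuity
import Literature.NumberTheory.LFunctions.DeBruijnNewmanUpperBoundProofs
import HarnessLib

/-!
# RiemannHypothesis / DBN — RH-FREE lemma K2a: simple real zeros of `H_t` stay real (compact boxes)

LINE 1 — LABEL: **RH-FREE** (generic continuity / complex-analysis statements about de Bruijn's
family `H_t = Literature.NumberTheory.LFunctions.deBruijnH t`; no ζ-zero input, no statement about
`Λ`).  bears_on: N-C/N-P (LADDER-RH §1, COLUMN 3 DBN; lemma K2a of `rh-crit/rt/RESIDUAL.md` §3,
feeding the RH-FREE leaf K2 `DbnTheory.CoalescenceAtLambda`).  WHAT THIS IS NOT: not a zero-free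
region, not a statement uniform as `t ↓ 0`, not evidence about RH — nothing here bears on the truth
of RH.

**K2a (persistence).**  Let `K ⊂ ℂ` be compact and suppose every zero of `H_{t₀}` in `K` is real
and simple.  Then for all `t` near `t₀` (both sides) every zero of `H_t` in `K` is real
(`eventually_im_eq_zero_of_zero`).  Proof (no argument principle needed): the zeros of `H_{t₀}` in
`K` are finitely many (`finite_deBruijnH_zeros_of_isCompact`); around each such zero `x ∈ ℝ` the
derivative `H_t'(w)` stays within `‖H_{t₀}'(x)‖/2` of `H_{t₀}'(x) ≠ 0` for `(t, w)` near `(t₀, x)`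
(joint continuity `continuous_deriv_deBruijnH_uncurry`), so `H_t` is INJECTIVE on a closed disc
`D_x` around `x` (mean value inequality, `injOn_of_norm_deriv_sub_le`); the zero set of `H_t` is
conjugation-symmetric (`deBruijnH_conj_eq_zero`) and so is `D_x`, hence a zero of `H_t` in `D_x`
equals its conjugate, i.e. is real; off the open discs, `H_{t₀} ≠ 0` on the compact remainder, so
`H_t ≠ 0` there for `t` near `t₀` (tube lemma).  Box forms: `exists_delta_im_eq_zero_box`
(`|Re z| ≤ X`, `|Im z| ≤ Y`) and, for `t₀ > 0` where zeros have `|Im z| < 1`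
(`Polymath15.abs_im_lt_one_of_zero`), `exists_delta_im_eq_zero_of_pos` (`|Re z| ≤ X` only).

`--supports stmt-RiemannHypothesis-0274` (route DBN target X); closes nothing.  Theorems only.

References (context only; the content is folklore complex analysis): B. Rodgers, T. Tao, Forum
Math. Pi 8 (2020) e6, Thm. 4.1 (continuity of the zeros, after Csordas–Smith–Varga 1994).
-/

noncomputable section

-- D-0017: `Summit.<S>.<S>.…` is the designed namespace of a single-problem summit.
set_option linter.dupNamespace false

namespace Summit.RiemannHypothesis.RiemannHypothesis.Theorems.DbnTheory

open Literature.NumberTheory.LFunctions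
open Complex Filter Set Topology Metric

/-! ## A generic injectivity criterion -/

/-- **Injectivity from a pinned derivative** (mean value inequality on a convex set): if `f` is
complex-differentiable on the convex set `s` and `‖f'(w) − d‖ ≤ ‖d‖/2` on `s` for some `d ≠ 0`,
then `f` is injective on `s`. [folklore] -/
theorem injOn_of_norm_deriv_sub_le {f : ℂ → ℂ} {s : Set ℂ} (hs : Convex ℝ s)
    (hf : ∀ w ∈ s, DifferentiableAt ℂ f w) {d : ℂ} (hd : d ≠ 0)
    (hbound : ∀ w ∈ s, ‖deriv f w - d‖ ≤ ‖d‖ / 2) : Set.InjOn f s := by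
  intro x hx y hy hxy
  set g : ℂ → ℂ := fun w ↦ f w - d * w with hg
  have hgd : ∀ w ∈ s, HasDerivAt g (deriv f w - d) w := by
    intro w hw
    have h1 : HasDerivAt f (deriv f w) w := (hf w hw).hasDerivAt
    have h2 : HasDerivAt (fun w : ℂ ↦ d * w) d w := by
      simpa using (hasDerivAt_id w).const_mul d
    exact h1.sub h2
  have hgdiff : ∀ w ∈ s, DifferentiableAt ℂ g w := fun w hw ↦ (hgd w hw).differentiableAt
  have hgbound : ∀ w ∈ s, ‖deriv g w‖ ≤ ‖d‖ / 2 := by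
    intro w hw
    rw [(hgd w hw).deriv]
    exact hbound w hw
  have key := hs.norm_image_sub_le_of_norm_deriv_le hgdiff hgbound hx hy
  have hgxy : g y - g x = -(d * (y - x)) := by
    simp only [hg, hxy]; ring
  rw [hgxy, norm_neg, norm_mul] at key
  have hd0 : 0 < ‖d‖ := norm_pos_iff.2 hd
  have hyx : ‖y - x‖ = 0 := by nlinarith [norm_nonneg (y - x)]
  have := sub_eq_zero.1 (norm_eq_zero.1 hyx)
  exact this.symm

/-! ## K2a: persistence of real-rootedness near simple real zeros -/

/-- **Local form.** If `x` is real and `H_{t₀}'(x) ≠ 0`, then there is `r > 0` such that for all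
`t` near `t₀` every zero of `H_t` in the closed disc `D(x, r)` is real (injectivity of `H_t` on
the disc + conjugation symmetry of the zero set). [folklore] -/
theorem exists_radius_eventually_im_eq_zero {t₀ : ℝ} {x : ℂ} (hx : x.im = 0)
    (hd : deriv (deBruijnH t₀) x ≠ 0) :
    ∃ r : ℝ, 0 < r ∧ ∀ᶠ t in 𝓝 t₀, ∀ w ∈ closedBall x r, deBruijnH t w = 0 → w.im = 0 := by
  set d : ℂ := deriv (deBruijnH t₀) x with hdd
  have hd0 : 0 < ‖d‖ / 2 := by have := norm_pos_iff.2 hd; positivity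
  have hcont := (continuous_deriv_deBruijnH_uncurry.continuousAt (x := (t₀, x)))
  rw [Metric.continuousAt_iff] at hcont
  obtain ⟨ρ, hρ, hρd⟩ := hcont (‖d‖ / 2) hd0
  refine ⟨ρ / 2, by positivity, ?_⟩
  have hball : ball t₀ (ρ / 2) ∈ 𝓝 t₀ := ball_mem_nhds _ (by positivity)
  filter_upwards [hball] with t ht
  -- injectivity of `H_t` on the closed disc
  have hinj : Set.InjOn (deBruijnH t) (closedBall x (ρ / 2)) := by
    refine injOn_of_norm_deriv_sub_le (convex_closedBall x (ρ / 2))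
      (fun w _ ↦ (differentiable_deBruijnH_holds t) w) hd fun w hw ↦ ?_
    have hdist : dist (t, w) (t₀, x) < ρ := by
      rw [Prod.dist_eq]
      refine max_lt ?_ ?_
      · have : dist t t₀ < ρ / 2 := mem_ball.1 ht
        linarith
      · have : dist w x ≤ ρ / 2 := mem_closedBall.1 hw
        linarith
    have := hρd hdist
    rw [dist_eq_norm] at this
    exact this.le
  intro w hw hw0
  -- the conjugate is a zero in the same disc
  have hxc : (starRingEnd ℂ) x = x := Complex.conj_eq_iff_im.2 hx
  have hw' : (starRingEnd ℂ) w ∈ closedBall x (ρ / 2) := by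
    rw [mem_closedBall, dist_eq_norm] at hw ⊢
    rw [← hxc, ← map_sub, Complex.norm_conj]
    exact hw
  have hw0' : deBruijnH t ((starRingEnd ℂ) w) = 0 := deBruijnH_conj_eq_zero hw0
  have heq : (starRingEnd ℂ) w = w := hinj hw' hw (by rw [hw0', hw0])
  exact Complex.conj_eq_iff_im.1 heq

/-- **K2a, compact form.**  If every zero of `H_{t₀}` in the compact set `K ⊂ ℂ` is real and
simple, then for all `t` in a neighbourhood of `t₀` every zero of `H_t` in `K` is real.
[folklore] -/
theorem eventually_im_eq_zero_of_zero {t₀ : ℝ} {K : Set ℂ} (hK : IsCompact K)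
    (hreal : ∀ z ∈ K, deBruijnH t₀ z = 0 → z.im = 0)
    (hsimple : ∀ z ∈ K, deBruijnH t₀ z = 0 → deriv (deBruijnH t₀) z ≠ 0) :
    ∀ᶠ t in 𝓝 t₀, ∀ z ∈ K, deBruijnH t z = 0 → z.im = 0 := by
  set Z : Set ℂ := {z : ℂ | z ∈ K ∧ deBruijnH t₀ z = 0} with hZ
  have hZfin : Z.Finite := finite_deBruijnH_zeros_of_isCompact t₀ hK
  have hrad : ∀ z ∈ Z, ∃ r : ℝ, 0 < r ∧
      ∀ᶠ t in 𝓝 t₀, ∀ w ∈ closedBall z r, deBruijnH t w = 0 → w.im = 0 :=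
    fun z hz ↦ exists_radius_eventually_im_eq_zero (hreal z hz.1 hz.2) (hsimple z hz.1 hz.2)
  choose! r hr0 hr using hrad
  set U : Set ℂ := ⋃ z ∈ Z, ball z (r z) with hU
  have hUo : IsOpen U := isOpen_biUnion fun z _ ↦ isOpen_ball
  have hK' : IsCompact (K \ U) := hK.diff hUo
  have hne : ∀ w ∈ K \ U, deBruijnH t₀ w ≠ 0 := by
    rintro w ⟨hwK, hwU⟩ hw0
    exact hwU (mem_iUnion₂.2 ⟨w, ⟨hwK, hw0⟩, mem_ball_self (hr0 w ⟨hwK, hw0⟩)⟩)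
  have htube : ∀ᶠ t in 𝓝 t₀, ∀ w ∈ K \ U, deBruijnH t w ≠ 0 := by
    refine hK'.eventually_forall_of_forall_eventually fun w hw ↦ ?_
    exact continuous_deBruijnH_uncurry.continuousAt.eventually_ne (hne w hw)
  have hballs : ∀ᶠ t in 𝓝 t₀, ∀ z ∈ Z, ∀ w ∈ closedBall z (r z),
      deBruijnH t w = 0 → w.im = 0 :=
    hZfin.eventually_all.2 hr
  filter_upwards [htube, hballs] with t ht hb w hwK hw0
  by_cases hwU : w ∈ U
  · obtain ⟨z, hz, hwz⟩ := mem_iUnion₂.1 hwU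
    exact hb z hz w (ball_subset_closedBall hwz) hw0
  · exact absurd hw0 (ht w ⟨hwK, hwU⟩)

/-- The closed box `{|Re z| ≤ X, |Im z| ≤ Y}` is compact. [folklore] -/
theorem isCompact_reImBox (X Y : ℝ) : IsCompact {z : ℂ | |z.re| ≤ X ∧ |z.im| ≤ Y} := by
  refine Metric.isCompact_of_isClosed_isBounded ?_ ?_
  · exact (isClosed_le (continuous_abs.comp Complex.continuous_re) continuous_const).inter
      (isClosed_le (continuous_abs.comp Complex.continuous_im) continuous_const)
  · rw [isBounded_iff_forall_norm_le]
    refine ⟨X + Y, fun z hz ↦ ?_⟩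
    exact (Complex.norm_le_abs_re_add_abs_im z).trans (add_le_add hz.1 hz.2)

/-- **K2a, box form.**  If `H_{t₀}` has only real zeros and every real zero of `H_{t₀}` is simple,
then for every box `|Re z| ≤ X`, `|Im z| ≤ Y` there is `δ > 0` such that for `|t − t₀| < δ` every
zero of `H_t` in the box is real. [folklore] -/
theorem exists_delta_im_eq_zero_box {t₀ : ℝ} (X Y : ℝ)
    (hreal : HasOnlyRealZeros (deBruijnH t₀))
    (hsimple : ∀ x : ℝ, deBruijnH t₀ x = 0 → deriv (deBruijnH t₀) x ≠ 0) :
    ∃ δ : ℝ, 0 < δ ∧ ∀ t : ℝ, |t - t₀| < δ → ∀ z : ℂ, deBruijnH t z = 0 →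
      |z.re| ≤ X → |z.im| ≤ Y → z.im = 0 := by
  have hsimple' : ∀ z ∈ {z : ℂ | |z.re| ≤ X ∧ |z.im| ≤ Y}, deBruijnH t₀ z = 0 →
      deriv (deBruijnH t₀) z ≠ 0 := by
    intro z _ hz
    have him : z.im = 0 := hreal z hz
    have hzre : ((z.re : ℝ) : ℂ) = z := Complex.ext (by simp) (by simp [him])
    have := hsimple z.re (by rw [hzre]; exact hz)
    rwa [hzre] at this
  have h := eventually_im_eq_zero_of_zero (isCompact_reImBox X Y) (fun z _ hz ↦ hreal z hz) hsimple'
  obtain ⟨δ, hδ, hδP⟩ := Metric.eventually_nhds_iff.1 h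
  refine ⟨δ, hδ, fun t ht z hz hre him ↦ ?_⟩
  exact hδP (by rwa [Real.dist_eq]) z ⟨hre, him⟩ hz

/-- **K2a for positive times** (the form used by K2): if `t₀ > 0`, `H_{t₀}` has only real zeros and
all of them are simple, then for every `X` there is `δ ∈ (0, t₀]` such that for `|t − t₀| < δ`
(so `t > 0`) every zero of `H_t` with `|Re z| ≤ X` is real — the a-priori bound `|Im z| < 1` for
zeros of `H_t`, `t ≥ 0`, being `Polymath15.abs_im_lt_one_of_zero` (critical strip + de Bruijn's
Thm. 13). [folklore] -/
theorem exists_delta_im_eq_zero_of_pos {t₀ : ℝ} (ht₀ : 0 < t₀) (X : ℝ)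
    (hreal : HasOnlyRealZeros (deBruijnH t₀))
    (hsimple : ∀ x : ℝ, deBruijnH t₀ x = 0 → deriv (deBruijnH t₀) x ≠ 0) :
    ∃ δ : ℝ, 0 < δ ∧ δ ≤ t₀ ∧ ∀ t : ℝ, |t - t₀| < δ → ∀ z : ℂ, deBruijnH t z = 0 →
      |z.re| ≤ X → z.im = 0 := by
  obtain ⟨δ, hδ, hδP⟩ := exists_delta_im_eq_zero_box X 1 hreal hsimple
  refine ⟨min δ t₀, lt_min hδ ht₀, min_le_right _ _, fun t ht z hz hre ↦ ?_⟩
  have ht' : |t - t₀| < δ := lt_of_lt_of_le ht (min_le_left _ _)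
  have htpos : 0 ≤ t := by
    have := lt_of_lt_of_le ht (min_le_right _ _)
    rw [abs_lt] at this
    linarith
  exact hδP t ht' z hz hre (Polymath15.abs_im_lt_one_of_zero htpos hz).le

end Summit.RiemannHypothesis.RiemannHypothesis.Theorems.DbnTheory

end
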